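import Summits.Ventures.HSemireg.Mod4TwoSlopeSpectrumGeneral

/-!
# Venture HSemireg — MOD-4 line: the ONE-SLOPE h-part `f = A e^{λh}` (`q_m = A λ^m`): `M_f(q) = 0`, `rank H_k(q) = 1`, `P_f(q) = 0`
# (TABLE R's `ρ(f) = 1` row for EVERY `n`: `R_m = 3C(2n,m) − 2C(n,m)`, `R_n = 3C(2n,n) − 2`)

HONEST FRAMING. Part of the Lean index of the computation cell `pub-hsemireg` (seat w3-mod4-1 gen 9, W3 SPECIAL FIBRES; file of
record `HOME/widen/W3/MOD4-OFFSPLIT-w3mod4.md`, TABLE R row «`ρ(f) = 1`: `(1,8,16,8,1) / (1,12,39,58,39,12,1) / …`», THEOREM A's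
semihomogeneous shapes `A·e^{λh} + w`). ELEMENTARY LINEAR ALGEBRA over a field ONLY: no abelian variety, no sheaf, no Ext group, no
semiregularity map; nothing here says that HC / HC_CM / HC_AV holds; no Literature fact is declared; NO definition is introduced.

WHAT IS PROVED (the `B = 0` specialisation of `Mod4TwoSlopeSpectrumGeneral`, which needs `B ≠ 0` for its rank statements):
* `middleM_oneSlope_mulVec` — `M_f(q) v = 0` for `q_m = A λ^m`, `n ≥ 1` (`T_f` has rank one and square zero);
* **`finrank_ker_middleM_oneSlope`** — `t ≠ 0` ⇒ `dim ker(M_f(q) − t) = 0`;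
* **`hankel1_rank_oneSlope`** — `A ≠ 0`, `k ≤ N`: `rank H_k(q) = 1` (range = the line of `(λ^i)_i`);
* **`mukaiP_oneSlope`** — `Σ_{j ≤ 2n} (-1)^j C(2n,j) q_j q_{2n-j} = 0` (`n ≥ 1`): `(f,f)_χ = 0` for a semihomogeneous h-part.
Everything PROVED, 0 sorry. Namespace `Summit.Ventures.HSemireg.Mod4`.
References: [BourbakiAlgebre1a3] Ch. III §8; [BuchweitzFlenner2008HH] Prop. 6.4.4 (why this matrix).
-/

namespace Summit.Ventures.HSemireg.Mod4

open Finset Matrix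

variable {K : Type*} [Field K]

/-- **`M_f(q) = 0` on every vector** for the one-slope sequence `q_m = A λ^m` (`n ≥ 1`). [cite: BourbakiAlgebre1a3, Ch. III §8] -/
theorem middleM_oneSlope_mulVec {n : ℕ} (hn : 1 ≤ n) (A la : K) (v : Fin (n + 1) → K) :
    (middleM n (fun m => A * la ^ m)) *ᵥ v = 0 := by
  have hq : (fun m => A * la ^ m) = fun m => A * la ^ m + 0 * la ^ m := funext fun m => by rw [zero_mul, add_zero]
  rw [hq, middleM_twoSlope_mulVec hn]
  simp only [mul_zero, zero_mul, zero_smul, add_zero]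

/-- **`ρ(f) = 1`, middle matrix:** `t ≠ 0` ⇒ `dim ker(M_f(q) − t) = 0` for `q_m = A λ^m` (`n ≥ 1`). [cite: BourbakiAlgebre1a3, Ch. III §8] -/
theorem finrank_ker_middleM_oneSlope {n : ℕ} (hn : 1 ≤ n) (A la : K) {t : K} (ht0 : t ≠ 0) :
    Module.finrank K ↥(LinearMap.ker (Matrix.toLin' (middleM n (fun m => A * la ^ m)) - t • LinearMap.id)) = 0 := by
  rw [Submodule.finrank_eq_zero, LinearMap.ker_eq_bot']
  intro v hv
  rw [LinearMap.sub_apply, Matrix.toLin'_apply, LinearMap.smul_apply, LinearMap.id_apply, middleM_oneSlope_mulVec hn,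
    zero_sub, neg_eq_zero] at hv
  exact (smul_eq_zero.mp hv).resolve_left ht0

/-- **`rank H_k(q) = 1`** for `q_m = A λ^m`, `A ≠ 0`, `k ≤ N` (`H_k(q)_{i,s} = A λ^{i+s}`: the range is the line of `(λ^i)_i`,
reached by the column `s = 0`). [cite: BourbakiAlgebre1a3, Ch. III §8] -/
theorem hankel1_rank_oneSlope {N k : ℕ} (hkN : k ≤ N) {A : K} (la : K) (hA : A ≠ 0) :
    (Wedge.Hankel.hankel1 K N k (fun m => A * la ^ m)).rank = 1 := by
  classical
  set H := Wedge.Hankel.hankel1 K N k (fun m => A * la ^ m) with hH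
  set gl : Fin (k + 1) → K := fun i => la ^ (i : ℕ) with hgl
  have hmul : ∀ v : Fin (N + 1 - k) → K, H *ᵥ v = (A * ∑ s : Fin (N + 1 - k), la ^ (s : ℕ) * v s) • gl := by
    intro v
    ext i
    simp only [hH, Wedge.Hankel.hankel1, mulVec, dotProduct, Matrix.of_apply, hgl, Pi.smul_apply, smul_eq_mul, Finset.mul_sum,
      Finset.sum_mul]
    refine Finset.sum_congr rfl fun s _ => ?_
    rw [pow_add]
    ring
  have hgl0 : gl ≠ 0 := by
    intro h
    have h0 := congr_fun h ⟨0, by omega⟩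
    simp only [hgl, Pi.zero_apply, pow_zero] at h0
    exact one_ne_zero h0
  have hrange : LinearMap.range H.mulVecLin = K ∙ gl := by
    apply le_antisymm
    · rintro _ ⟨v, rfl⟩
      rw [Matrix.mulVecLin_apply, hmul]
      exact Submodule.smul_mem _ _ (Submodule.mem_span_singleton_self gl)
    · rw [Submodule.span_singleton_le_iff_mem]
      have hcol : H *ᵥ Pi.single (⟨0, by omega⟩ : Fin (N + 1 - k)) 1 = A • gl := by
        rw [hmul]
        simp only [Pi.single_apply, mul_ite, mul_one, mul_zero, Finset.sum_ite_eq', Finset.mem_univ, if_true, pow_zero]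
      have hmem : H *ᵥ Pi.single (⟨0, by omega⟩ : Fin (N + 1 - k)) 1 ∈ LinearMap.range H.mulVecLin := ⟨_, rfl⟩
      rw [hcol] at hmem
      rw [show gl = A⁻¹ • (A • gl) by rw [smul_smul, inv_mul_cancel₀ hA, one_smul]]
      exact Submodule.smul_mem _ _ hmem
  change Module.finrank K ↥(LinearMap.range H.mulVecLin) = 1
  rw [hrange, finrank_span_singleton hgl0]

/-- **`P_f(q) = 0`** for `q_m = A λ^m`, `n ≥ 1`: `Σ_{j ≤ 2n} (-1)^j C(2n,j) q_j q_{2n-j} = A²(λ-λ)^{2n} = 0` — the Mukai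
self-pairing of a semihomogeneous h-part vanishes. [cite: BourbakiAlgebre1a3, Ch. III §8] -/
theorem mukaiP_oneSlope {n : ℕ} (hn : 1 ≤ n) (A la : K) :
    ∑ j ∈ Finset.range (n + n + 1), (-1 : K) ^ j * (((n + n).choose j : ℕ) : K) *
        ((A * la ^ j) * (A * la ^ (n + n - j))) = 0 := by
  have h := mukaiP_twoSlope hn A 0 la la
  simpa only [zero_mul, add_zero, mul_zero] using h

end Summit.Ventures.HSemireg.Mod4
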